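import Summits.BirchSwinnertonDyer.Rank1Residual.Additive.X4RankZeroUpperHalfOfShaDvdCyc
import Summits.BirchSwinnertonDyer.Rank1Residual.Additive.CongruentPartnerMainConjectureGordBSD
import Summits.BirchSwinnertonDyer.Rank1Residual.Additive.BudgetFromSelmerGroup
import HarnessLib

/-!
# X4♯(G-ord), rank `0`, `p = 3`: the UPPER half and route 2's class END of record with Delbourgo 1998
# Prop. 4 SUPPLIED AT THE PAIR by Delbourgo 2002 Theorem (B) at `3` — `hDel98` OUT, nothing added
# (cell `b2b-bsdres`, team n1011, ROW T-DEL98X, seat p10 GEN 10, FILE 2b)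

HONEST FRAMING (cell `b2b-bsdres`, run/shared/lean/b2b/bsd-rank1-residual/, verbatim in every
file): the goal of the cell is to DELETE the COMBINATION-SHAPED residual classes of the
Birch–Swinnerton-Dyer formula for ALL analytic-rank `≤ 1` elliptic curves over `ℚ` — "full BSD
formula for every rank `≤ 1` curve in class `C`" assembled STRICTLY from published theorems — so
that the rank-`≤ 1` remainder becomes exactly the CONSTRUCTION-SHAPED classes, which are TYPED
(missing-input `Prop`s), NOT attempted. This is not "finishing BSD". Team n1011 (N10 / N11, the
additive block `X4 ∧ p = 3`): research route; TOOL + END-twin theorems only — no definition, no named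
fact, no `sorry`; nothing booked; no residual-map mark / label / count moved; X4♯(G-ord) stays
CONSTRUCTION-SHAPED. NOTHING of additive-p2's / additive-p4's / p06's / p14's / r2's is edited: every
declaration below is NEW and consumes theirs BY NAME.

## What and why

On X4♯(G-ord) at `p = 3` (additive, potentially good ORDINARY, defect `e = 2`, `I₀*`) the rank-`0`
class ENDs display BOTH `hDel98 : Delbourgo1998.prop4_rankZero_pow_dvd_constantCoeff` (A75: for every
`g ∈ char_Λ X`, `3 ^ (ord₃ #Ш[3^∞] + ord₃ ∏ᶠ_{v∤3} c_v) ∣ g(0) · #E(ℚ)²` — the UPPER half's control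
input) AND `hDel3 : Delbourgo2002.mainTheorem_three` (Theorem (A)+(B) at `3`: `X` torsion and, in rank
`0`, the EXACT leading term `fE(0) · #E(ℚ)_{tors}² = u · ℓ · #Ш[3^∞] · ∏ c_v`, `ℓ ∣ 9` — the LOWER
half's input). On a non-CM pair of analytic rank `0` the exact formula IMPLIES A75's divisibility AT
THE PAIR for the cyclotomic-variable generator (`char = (fE)`, every `g = h · fE`; the factors `ℓ` and
`c₃` sit on the helping side): §1. FILE 2a (`Additive/X4RankZeroUpperHalfOfShaDvdCyc`) re-ran the
Gord@3 upper half on exactly that supplier shape, so: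

* §1 `TypeGOrd.shaDvdCycAt_three_of_delbourgo2002`, `ClassX4Gord.…` — the supplier from `hDel3`.
* §2 `ClassX4Gord.missingUpperBoundAt_three_of_katoComponent_of_surj_of_exactLeadingTerm` — the Gord@3
  UPPER half from {Kato component divisibility `hK`, `hDel3`, GZK, `hmod`, `hmodD`} on non-CM rank-`0`
  rows (the tree's `ClassX4Gord.missingUpperBoundAt_three_of_katoComponent_of_surj` with
  `{hDel} ↦ {hDel3, hcm}`), + `…bsdp_three_of_katoComponent_of_surj_of_lower_of_exactLeadingTerm`.
* §3 END TWINS with binder diff EXACTLY {`hDel98`} ↦ ∅, NOTHING added (every one already displays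
  `hDel3` and `hcm`), conclusion and row universe identical:
  - `ClassX4Gord.bsdp_three_rankZero_of_cycLower_of_nonAnomalous_of_surj_noDel98` (additive-p2's
    `GordThreeCycLowerCore` END: 6 ↦ 5);
  - `ClassX4Gord.bsdp_three_rankZero_of_katoHalf_of_coeffCert_of_budget_of_nonAnomalous_noPal_noDel98`
    (p10 GEN 2's Route-G END: 6 ↦ 5 = {hK, hDel3, hGZK, hmod, hmodD});
  - `ClassX4Gord.bsdp_three_rankZero_of_katoHalf_of_coeffCert_of_pow_le_card_selmerGroup_of_nonAnomalous_noDel98`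
    — ROUTE 2's Gord END OF RECORD (ARM σ, `Additive/BudgetFromSelmerGroup.lean:136`): 7 ↦ 6 =
    {hK, hDel3, hGZK, hmod, hmodD, h414}, with NO `B = 0` / place-set binder (so the `3 ∣ Tam` row
    `437742q1` is served, unlike the Prop-4.14 twin of T-CTL-UP FILE 6 — the two twins are
    complementary, r2 GEN 43 2026-08-22T07:54Z).

What is NOT claimed: no row is closed (every receiver stays conditional on its typed per-row exhibits
`hcert` / `hSel` / `hna` / `hLow`); A75 stays the input of every Gord END at `p ≥ 5` (there the exact
fact is `Delbourgo2002.mainTheorem`, same mechanism — not in this file) and of the CM rows; the X3♯(G-ord)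
twins (Wuthrich Thm. 16 instead of Kato; the reducible odd core) are not in this file. Axioms standard.

References: D. Delbourgo, J. Number Theory 95 (2002) 38–71, Theorem (A), (B) (p. 40), Hypothesis
(p. 39) [Delbourgo2002]; D. Delbourgo, Compositio Math. 113 (1998) Prop. 4 (p. 144) [Delbourgo1998];
K. Kato, Astérisque 295 (2004) Thm. 17.4 (3) (p. 273) [Kato2004Asterisque]; R. Greenberg, LNM 1716
(1999) Prop. 4.14 [GreenbergLNM1716]; R. L. Miller, LMS J. Comput. Math. 14 (2011) Def. 1.1
[Miller2011LMS]; cells/n1011/PLAN.md §K.2 (D-2); names line cells/n1011/INBOX.md 2026-08-22T07:53Z;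
lead R5-106 (t); r2 GEN 43 pricing pre-statement 2026-08-22T07:54Z.
-/

noncomputable section

open scoped Classical MatrixGroups ModularForm NumberField

open CongruenceSubgroup WeierstrassCurve NumberField Literature.NumberTheory.EllipticCurves
  Literature.NumberTheory.EllipticCurves.ModularForms
  Literature.NumberTheory.EllipticCurves.Rank1Residual
  Literature.NumberTheory.EllipticCurves.Rank1Residual.Typed
  IsDedekindDomain Rat.HeightOneSpectrum

namespace Summit.BirchSwinnertonDyer.Rank1Residual.Additive

open AdditivePotMult

variable {W : WeierstrassCurve ℚ} [W.IsElliptic] [W.IsGloballyMinimal]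

/-! ### §1 Delbourgo 2002 (B) at `3` supplies Delbourgo 1998 Prop. 4 AT THE PAIR -/

/-- **Delbourgo 2002 (B) at `3` ⟹ A75's divisibility AT THE PAIR, for the cyclotomic-variable
generator.** On an additive pair `(E, 3)` of type (G)-ordinary (`TypeGOrd W 3`), non-CM: for the
cyclotomic `ℤ₃`-extension, every topological generator `γ` MATCHING THE CYCLOTOMIC VARIABLE, every
Pontryagin-dual datum `D` of `Sel_{3^∞}(E/ℚ_∞)`, `E(ℚ)` and `Ш(E)` finite, and every `g ∈ char_Λ X`:
`3 ^ (ord₃ #Ш(E)[3^∞] + ord₃ ∏ᶠ_{v∤3} c_v) ∣ g(0) · #E(ℚ)²` in `ℤ₃` — FILE 2a's supplier shape `hdivCyc`.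
Proof: `char_Λ X = (fE)` (`Λ` a UFD, `charIdeal_isPrincipal_holds`), `X` torsion (Theorem (A)) and
finitely generated (`SelmerDualData.module_finite_of_isCyclotomic`); Theorem (B) in rank `0`
(`Delbourgo2002.LeadingTermClauses.constantCoeff`): `fE(0) · #E(ℚ)_{tors}² = u · ℓ · #Ш[3^∞] · ∏ c_v`
with `u ∈ ℤ₃^×`, `ℓ ∣ 9`; `#E(ℚ) = #E(ℚ)_{tors}`, `∏ c_v = c₃ · ∏ᶠ_{v∤3} c_v`
(`tamagawaProduct_eq_tamagawaNumberAt_mul_finprod`), `3 ^ ord₃ n ∣ n`, and `g = h · fE`.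
[cite: Delbourgo2002, Theorem (A), (B) (p. 40), Hypothesis (p. 39)]
[cite: Delbourgo1998, Prop. 4 (p. 144) (the supplied statement)] -/
theorem TypeGOrd.shaDvdCycAt_three_of_delbourgo2002 [Fact (Nat.Prime 3)]
    (hDel3 : Delbourgo2002.mainTheorem_three) (hG : TypeGOrd W 3) (hadd : Addv W 3)
    (hcm : ¬ W.HasCM) :
    ∀ (κ : ZpExtension ℚ 3) (γ : Field.absoluteGaloisGroup ℚ), κ.IsCyclotomic →
      κ.IsTopGenerator γ → IsCyclotomicVariable 3 γ →
      ∀ D : W.SelmerDualData κ γ, Finite W.sha → Finite W.toAffine.Point →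
      ∀ g ∈ D.charIdeal,
        (3 : ℤ_[3]) ^ (padicValNat 3 (Nat.card (AddCommGroup.primaryComponent W.sha 3)) +
            padicValNat 3 (∏ᶠ v : HeightOneSpectrum (𝓞 ℚ),
              if ((3 : ℕ) : 𝓞 ℚ) ∈ v.asIdeal then 1 else W.tamagawaNumberAt v)) ∣
          PowerSeries.constantCoeff g * ((Nat.card W.toAffine.Point : ℕ) : ℤ_[3]) ^ 2 := by
  intro κ γ hκ hγ hγ' D hfin hE g hg
  obtain ⟨hA, Dh, hB⟩ := hG.delbourgo2002_three hDel3 hadd hcm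
  haveI : Finite W.sha := hfin
  haveI : Finite W.toAffine.Point := hE
  have hfinp : Finite (AddCommGroup.primaryComponent W.sha 3) :=
    Finite.of_injective _ Subtype.val_injective
  haveI : Module.Finite (IwasawaAlgebra 3) D.X :=
    SelmerDualData.module_finite_of_isCyclotomic (W := W) (κ := κ) hκ D hγ
  haveI : (Module.charIdeal (IwasawaAlgebra 3) D.X).IsPrincipal := charIdeal_isPrincipal_holds 3 D.X
  obtain ⟨fE, hfE⟩ := Submodule.IsPrincipal.principal (Module.charIdeal (IwasawaAlgebra 3) D.X)
  obtain ⟨-, u, ℓ, -, -, heq⟩ := hB.constantCoeff hκ hγ hγ' D (hA κ γ hκ hγ D) hfE hfinp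
  -- names
  set S : ℕ := Nat.card (AddCommGroup.primaryComponent W.sha 3) with hS
  set T : ℕ := Nat.card W.toAffine.Point with hT
  set c : ℕ := W.tamagawaNumberAt ((primesEquiv (R := 𝓞 ℚ)).symm ⟨3, Nat.prime_three⟩) with hc
  set P' : ℕ := ∏ᶠ v : HeightOneSpectrum (𝓞 ℚ),
    (if ((3 : ℕ) : 𝓞 ℚ) ∈ v.asIdeal then 1 else W.tamagawaNumberAt v) with hP'
  have hTtors : W.torsionOrder = T := (W.natCard_point_eq_torsionOrder).symm
  have hPsplit : W.tamagawaProduct = c * P' := tamagawaProduct_eq_tamagawaNumberAt_mul_finprod W 3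
  -- the exact leading term, pulled back to `ℤ₃`
  have heqZ : (PowerSeries.constantCoeff fE : ℤ_[3]) * ((T : ℕ) : ℤ_[3]) ^ 2 =
      (u : ℤ_[3]) * (ℓ : ℤ_[3]) * ((S : ℤ_[3]) * ((c : ℤ_[3]) * (P' : ℤ_[3]))) := by
    have h : (((PowerSeries.constantCoeff fE : ℤ_[3]) * ((T : ℕ) : ℤ_[3]) ^ 2 : ℤ_[3]) : ℚ_[3]) =
        (((u : ℤ_[3]) * (ℓ : ℤ_[3]) * ((S : ℤ_[3]) * ((c : ℤ_[3]) * (P' : ℤ_[3]))) : ℤ_[3]) :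
          ℚ_[3]) := by
      push_cast
      rw [hTtors, hPsplit] at heq
      push_cast at heq
      exact heq
    exact PadicInt.ext h
  -- `g = h · fE`
  have hgmem : g ∈ Ideal.span {fE} := by
    change g ∈ Module.charIdeal (IwasawaAlgebra 3) D.X at hg
    rw [hfE] at hg
    exact hg
  rw [Ideal.mem_span_singleton'] at hgmem
  obtain ⟨h, rfl⟩ := hgmem
  -- `3 ^ ord₃ S ∣ S`, `3 ^ ord₃ P' ∣ P'`
  have hSd : (3 : ℤ_[3]) ^ padicValNat 3 S ∣ (S : ℤ_[3]) := by
    have := Nat.cast_dvd_cast (α := ℤ_[3]) (pow_padicValNat_dvd (p := 3) (n := S))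
    simpa only [Nat.cast_pow, Nat.cast_ofNat] using this
  have hPd : (3 : ℤ_[3]) ^ padicValNat 3 P' ∣ (P' : ℤ_[3]) := by
    have := Nat.cast_dvd_cast (α := ℤ_[3]) (pow_padicValNat_dvd (p := 3) (n := P'))
    simpa only [Nat.cast_pow, Nat.cast_ofNat] using this
  have hkey : (3 : ℤ_[3]) ^ (padicValNat 3 S + padicValNat 3 P') ∣
      (u : ℤ_[3]) * (ℓ : ℤ_[3]) * ((S : ℤ_[3]) * ((c : ℤ_[3]) * (P' : ℤ_[3]))) := by
    rw [pow_add]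
    exact Dvd.dvd.mul_left (mul_dvd_mul hSd (Dvd.dvd.mul_left hPd _)) _
  rw [map_mul, mul_assoc, heqZ]
  exact Dvd.dvd.mul_left hkey _

/-- **X4♯(G-ord) at `3`, non-CM: the supplier** (`ClassX4Gord` form of
`TypeGOrd.shaDvdCycAt_three_of_delbourgo2002`). [cite: Delbourgo2002, Theorem (A), (B) (p. 40)] -/
theorem ClassX4Gord.shaDvdCycAt_three_of_delbourgo2002 [Fact (Nat.Prime 3)]
    (hDel3 : Delbourgo2002.mainTheorem_three) (hX : ClassX4Gord W 3) (hcm : ¬ W.HasCM) :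
    ∀ (κ : ZpExtension ℚ 3) (γ : Field.absoluteGaloisGroup ℚ), κ.IsCyclotomic →
      κ.IsTopGenerator γ → IsCyclotomicVariable 3 γ →
      ∀ D : W.SelmerDualData κ γ, Finite W.sha → Finite W.toAffine.Point →
      ∀ g ∈ D.charIdeal,
        (3 : ℤ_[3]) ^ (padicValNat 3 (Nat.card (AddCommGroup.primaryComponent W.sha 3)) +
            padicValNat 3 (∏ᶠ v : HeightOneSpectrum (𝓞 ℚ),
              if ((3 : ℕ) : 𝓞 ℚ) ∈ v.asIdeal then 1 else W.tamagawaNumberAt v)) ∣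
          PowerSeries.constantCoeff g * ((Nat.card W.toAffine.Point : ℕ) : ℤ_[3]) ^ 2 :=
  hX.typeGOrd.shaDvdCycAt_three_of_delbourgo2002 hDel3 hX.addv.2 hcm

/-! ### §2 The Gord@3 upper half and `BSD(E,3)` from {hK, hDel3, hGZK, hmod, hmodD} on non-CM rows -/

/-- **X4♯(G-ord) ∧ `p = 3` ∧ `r_an = 0` ∧ surj(3), non-CM: the UPPER half `ord₃ #Ш(E) ≤ ord₃ #Ш_an(E)`
from {Kato 2004 Thm. 17.4 (3) component reading `hK`, Delbourgo 2002 (A)+(B) at `3` `hDel3`, GZK,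
modularity `hmod` `hmodD`}** — the tree's `ClassX4Gord.missingUpperBoundAt_three_of_katoComponent_of_surj`
with the binder surgery `{hDel} ↦ {hDel3, hcm}` (FILE 2a's chain fed by §1). NO (ram), NO Tamagawa,
NO Manin binder. X4♯(G-ord) stays CONSTRUCTION-SHAPED. [cite: Kato2004Asterisque, Thm. 17.4 (3) (p. 273)]
[cite: Delbourgo2002, Theorem (A), (B) (p. 40), Hypothesis (p. 39)] [cite: Miller2011LMS, Def. 1.1] -/
theorem ClassX4Gord.missingUpperBoundAt_three_of_katoComponent_of_surj_of_exactLeadingTerm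
    [Fact (Nat.Prime 3)]
    (hK : Kato2004.charIdeal_dvd_padicLFunctionBranch_component_of_surjective)
    (hDel3 : Delbourgo2002.mainTheorem_three)
    (hGZK : rank_eq_analyticRank_of_analyticRank_le_one) (hmod : hasEntireLFunction_rat)
    (hmodD : nonempty_modularParametrizationData)
    (hX : ClassX4Gord W 3) (hcm : ¬ W.HasCM) (hr : W.analyticRank = 0) (hsurj : Surj W 3) :
    MissingUpperBoundAt W 3 :=
  ClassX4Gord.missingUpperBoundAt_three_of_katoComponent_of_surj_of_shaDvdCyc hK
    (hX.shaDvdCycAt_three_of_delbourgo2002 hDel3 hcm) hGZK hmod hmodD hX hr hsurj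

/-- **`BSD(E,3)` on X4♯(G-ord) ∧ `p = 3` ∧ `r_an = 0` ∧ surj(3), non-CM, from the LOWER half** — the
tree's `ClassX4Gord.bsdp_three_of_katoComponent_of_surj_of_lower` with `{hDel} ↦ {hDel3, hcm}`.
[cite: Kato2004Asterisque, Thm. 17.4 (3) (p. 273)] [cite: Delbourgo2002, Theorem (A), (B) (p. 40)]
[cite: Miller2011LMS, §1 and Def. 1.1] -/
theorem ClassX4Gord.bsdp_three_of_katoComponent_of_surj_of_lower_of_exactLeadingTerm
    [Fact (Nat.Prime 3)]
    (hK : Kato2004.charIdeal_dvd_padicLFunctionBranch_component_of_surjective)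
    (hDel3 : Delbourgo2002.mainTheorem_three)
    (hGZK : rank_eq_analyticRank_of_analyticRank_le_one) (hmod : hasEntireLFunction_rat)
    (hmodD : nonempty_modularParametrizationData)
    (hX : ClassX4Gord W 3) (hcm : ¬ W.HasCM) (hr : W.analyticRank = 0) (hsurj : Surj W 3)
    (hlow : MissingLowerBoundAt W 3) : BSDp W 3 :=
  ClassX4Gord.bsdp_three_of_katoComponent_of_surj_of_lower_of_shaDvdCyc hK
    (hX.shaDvdCycAt_three_of_delbourgo2002 hDel3 hcm) hGZK hmod hmodD hX hr hsurj hlow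

/-- **`BSD(E,3)` on X4♯(G-ord) ∧ `p = 3` ∧ `r_an = 0` ∧ surj(3), non-CM, `3 ∤ #Ш_an(E)`** —
`{hDel} ↦ {hDel3, hcm}` form of the tree's `ClassX4Gord.bsdp_three_of_katoComponent_of_surj_of_shaAn_unit`.
[cite: Kato2004Asterisque, Thm. 17.4 (3) (p. 273)] [cite: Delbourgo2002, Theorem (A), (B) (p. 40)]
[cite: Miller2011LMS, §1 and Def. 1.1] -/
theorem ClassX4Gord.bsdp_three_of_katoComponent_of_surj_of_shaAn_unit_of_exactLeadingTerm
    [Fact (Nat.Prime 3)]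
    (hK : Kato2004.charIdeal_dvd_padicLFunctionBranch_component_of_surjective)
    (hDel3 : Delbourgo2002.mainTheorem_three)
    (hGZK : rank_eq_analyticRank_of_analyticRank_le_one) (hmod : hasEntireLFunction_rat)
    (hmodD : nonempty_modularParametrizationData)
    (hX : ClassX4Gord W 3) (hcm : ¬ W.HasCM) (hr : W.analyticRank = 0) (hsurj : Surj W 3)
    {q : ℚ} (hq : shaAn W = (q : ℂ)) (hv : padicValRat 3 q = 0) : BSDp W 3 :=
  bsdp_of_missingPPartAt W 3 hGZK (by rw [hr]; exact zero_le_one)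
    (missingPPartAt_of_upper_of_shaAn_unit W 3
      (ClassX4Gord.missingUpperBoundAt_three_of_katoComponent_of_surj_of_exactLeadingTerm hK hDel3 hGZK
        hmod hmodD hX hcm hr hsurj) hq hv)

/-! ### §3 The class ENDs at `p = 3` with `hDel98` OUT, nothing added -/

/-- **END TWIN 1 — X4♯(G-ord) at `3` ∧ surj(3), rank `0`, non-CM, non-anomalous: `BSD(E,3)` ⟸ the
LOWER divisibility of Delbourgo's MC (G) at `T = 0` ALONE**, additive-p2's
`ClassX4Gord.bsdp_three_rankZero_of_cycLower_of_nonAnomalous_of_surj` (`Additive/GordThreeCycLowerCore.lean`)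
with binder diff EXACTLY {`hDel`} ↦ ∅, NOTHING added (named facts 6 ↦ 5 = {hDel3, hK, hGZK, hmod,
hmodD}; conclusion identical; the lower half `…missingLowerBoundAt_three_rankZero_of_cycLower_of_nonAnomalous`
consumed BY NAME). [cite: Delbourgo2002, Theorem (A), (B) (p. 40)] [cite: Kato2004Asterisque, Thm. 17.4 (3) (p. 273)]
[cite: Miller2011LMS, §1 and Def. 1.1] -/
theorem ClassX4Gord.bsdp_three_rankZero_of_cycLower_of_nonAnomalous_of_surj_noDel98 [Fact (Nat.Prime 3)]
    (hDel3 : Delbourgo2002.mainTheorem_three)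
    (hK : Kato2004.charIdeal_dvd_padicLFunctionBranch_component_of_surjective)
    (hGZK : rank_eq_analyticRank_of_analyticRank_le_one) (hmod : hasEntireLFunction_rat)
    (hmodD : nonempty_modularParametrizationData)
    (hX : ClassX4Gord W 3) (hcm : ¬ W.HasCM) (hr : W.analyticRank = 0) (hsurj : Surj W 3)
    (hna : Delbourgo2002.ReductionNonAnomalous W 3) (hLow : CycLowerLeadingTermAt W 3) : BSDp W 3 :=
  ClassX4Gord.bsdp_three_of_katoComponent_of_surj_of_lower_of_exactLeadingTerm hK hDel3 hGZK hmod hmodD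
    hX hcm hr hsurj
    (ClassX4Gord.missingLowerBoundAt_three_rankZero_of_cycLower_of_nonAnomalous hDel3 hGZK hmod hX hcm
      hr hna hLow)

/-- **END TWIN 2 — X4♯(G-ord) at `3` ∧ surj(3), `r_an = 0`, non-CM, non-anomalous: `BSD(E,3)` ⟸ ONE
3-adic unit coefficient at index `b` on the `ω`-branch of `E^{(−3)}` + the Route-G budget
`BudgetLeLambdaAt 3 W b`**, p10 GEN 2's
`ClassX4Gord.bsdp_three_rankZero_of_katoHalf_of_coeffCert_of_budget_of_nonAnomalous_noPal`
(`Additive/CongruentPartnerMainConjectureGordBSD.lean`) with binder diff EXACTLY {`hDel98`} ↦ ∅,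
NOTHING added (named facts 6 ↦ 5 = {hK, hDel3, hGZK, hmod, hmodD}; conclusion identical; the odd bridge
`…cycLowerLeadingTermAt_of_katoHalf_of_coeffCert_of_budget_of_mod_four_eq_three` consumed BY NAME).
[cite: Delbourgo2002, Theorem (A), (B) (p. 40), Hypothesis (p. 39)] [cite: Kato2004Asterisque, Thm. 17.4 (3) (p. 273)]
[cite: Miller2011LMS, §1 and Def. 1.1] -/
theorem ClassX4Gord.bsdp_three_rankZero_of_katoHalf_of_coeffCert_of_budget_of_nonAnomalous_noPal_noDel98
    [Fact (Nat.Prime 3)]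
    (hK : Wuthrich2014.kato_halfEigenCharIdeal_dvd_cyclotomicPrime_of_surjective)
    (hDel3 : Delbourgo2002.mainTheorem_three)
    (hGZK : rank_eq_analyticRank_of_analyticRank_le_one) (hmod : hasEntireLFunction_rat)
    (hmodD : nonempty_modularParametrizationData)
    (hX : ClassX4Gord W 3) (hcm : ¬ W.HasCM) (hsurj : Surj W 3) (hr : W.analyticRank = 0)
    {b : ℕ} (hcert : BranchUnitCoeffAt W 3 b) (hbud : BudgetLeLambdaAt 3 W b)
    (hna : Delbourgo2002.ReductionNonAnomalous W 3) : BSDp W 3 :=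
  have he : semistabilityIndex W 3 = 2 :=
    semistabilityIndex_eq_two_of_typeG_three W hX.typeGOrd.typeG hX.addv.2
  ClassX4Gord.bsdp_three_rankZero_of_cycLower_of_nonAnomalous_of_surj_noDel98 hDel3
    (Kato2004.charIdeal_dvd_padicLFunctionBranch_component_of_surjective_of_half hK) hGZK hmod hmodD hX
    hcm hr hsurj hna
    (hX.cycLowerLeadingTermAt_of_katoHalf_of_coeffCert_of_budget_of_mod_four_eq_three hK hmod hmodD he
      hsurj rfl hcert hbud)

/-- **END TWIN 3 — ROUTE 2's X4♯(G-ord) END OF RECORD (ARM σ): X4♯(G-ord) at `3` ∧ surj(3),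
`r_an = 0`, non-CM, non-anomalous (N11 (G-ord) rows, census status `OPEN:LOWER(pure)` /
`OPEN:LOWER+TAM`): `BSD(E,3)` ⟸ ONE 3-adic unit coefficient at index `b` + `3 ^ b ≤ #Sel⁽³⁾(E/ℚ)`**,
route 2's `ClassX4Gord.bsdp_three_rankZero_of_katoHalf_of_coeffCert_of_pow_le_card_selmerGroup_of_nonAnomalous`
(`Additive/BudgetFromSelmerGroup.lean`) with binder diff EXACTLY {`hDel98`} ↦ ∅, NOTHING added:
displayed named facts 7 ↦ 6 = {hK (Wuthrich 2014 / Kato half-eigen A136), hDel3 (Delbourgo 2002 at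
`3`), hGZK, hmod, hmodD, h414 (Greenberg Prop. 4.14)}; conclusion and row universe identical (no `B = 0`,
place-set or `hgood` binder: `3 ∣ Tam` rows included); the Ш-door
`budgetLeLambdaAt_of_prop414_of_pow_le_card_selmerGroup` consumed BY NAME. cells/n1011/PLAN.md §K.2
(D-2) — CANDIDATE only; referee-1 grades; complementary to T-CTL-UP FILE 6's `_of_prop414` twin of the
same END. Nothing booked. [cite: GreenbergLNM1716, Prop. 4.14 (p. 114)]
[cite: Delbourgo2002, Theorem (A), (B) (p. 40), Hypothesis (p. 39)] [cite: Kato2004Asterisque, Thm. 17.4 (3) (p. 273)]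
[cite: Miller2011LMS, §1 and Def. 1.1] -/
theorem ClassX4Gord.bsdp_three_rankZero_of_katoHalf_of_coeffCert_of_pow_le_card_selmerGroup_of_nonAnomalous_noDel98
    [Fact (Nat.Prime 3)]
    (hK : Wuthrich2014.kato_halfEigenCharIdeal_dvd_cyclotomicPrime_of_surjective)
    (hDel3 : Delbourgo2002.mainTheorem_three)
    (hGZK : rank_eq_analyticRank_of_analyticRank_le_one) (hmod : hasEntireLFunction_rat)
    (hmodD : nonempty_modularParametrizationData)
    (h414 : Greenberg1999.prop414_noFiniteSubmodule_of_not_dvd_torsionOrder)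
    (hX : ClassX4Gord W 3) (hcm : ¬ W.HasCM) (hsurj : Surj W 3) (hr : W.analyticRank = 0)
    {b : ℕ} (hcert : BranchUnitCoeffAt W 3 b) (hSel : 3 ^ b ≤ Nat.card (selmerGroup W (3 : ℤ)))
    (hna : Delbourgo2002.ReductionNonAnomalous W 3) : BSDp W 3 :=
  ClassX4Gord.bsdp_three_rankZero_of_katoHalf_of_coeffCert_of_budget_of_nonAnomalous_noPal_noDel98 hK
    hDel3 hGZK hmod hmodD hX hcm hsurj hr hcert
    (budgetLeLambdaAt_of_prop414_of_pow_le_card_selmerGroup h414 (not_dvd_torsionOrder_of_surj 3 W hsurj)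
      hSel) hna

end Summit.BirchSwinnertonDyer.Rank1Residual.Additive

end
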